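import Mathlib
import HarnessLib
import Literature.Geometry.DiscreteGeometry.BondGraph
import Literature.Geometry.DiscreteGeometry.KissingPatterns
import Literature.Geometry.DiscreteGeometry.LayerShells
import Literature.MathematicalPhysics.StatisticalMechanics.BarlowStacking
import Literature.MathematicalPhysics.StatisticalMechanics.HaggStacking
import Summits.AtomisticToContinuum.Crystallization.Theorems.PricedLinkCensusSoftLayerPropagationOneStackingMapSearchDefs
import Summits.AtomisticToContinuum.Crystallization.Theorems.PricedLinkCensusSoftLayerPropagationOneStackingMapSearchLeaf
import Summits.AtomisticToContinuum.Crystallization.Theorems.PricedLinkCensusSoftLayerPropagationOneStackingMapSearchBasic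
import Summits.AtomisticToContinuum.Crystallization.Theorems.PricedLinkCensusSoftLayerPropagationOneStackingMapLeafSound
import Summits.AtomisticToContinuum.Crystallization.Theorems.PricedLinkCensusSoftLayerPropagationOneStackingMapDev
import Summits.AtomisticToContinuum.Crystallization.Theorems.PricedLinkCensusSoftLayerPropagationOneStackingMapFrame

/-!
# One-stacking map engine: from the shadow-frame conclusion to the Barlow stacking

Route `PricedLinkCensus`, crux `SoftLayerPropagation` (stmt-AtomisticToContinuum-14233), line
`Sketch`, stub `stub_oneStackingMap`.  **`concl_of_dev`**: for the hypotheses `H : Hyp` of the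
stub and a one-stacking conclusion `C : H.dev.Concl` of the search (frame `F`, letters `L`:
membership / surjectivity / injectivity on the shadow ball `‖pos‖² ≤ 1089/50`), the stub's
conclusion holds with the Hägg sequence `haggOf L` and the rigid motion
`φ = Ψ ∘ Qᵢ⁻¹ ∘ (· − D i)` (`Ψ` the frame isometry of `…OneStackingMapFrame.lean`): then
`φ (D j) = a u + b v + c w + k √(2/3) e₃ = barlowPos 1 √(2/3) (haggOf L) k (a − q) (b − q)`
whenever `pos j = toE3 (F.pt k a b c)` (`haggLabel = c + 3q`, `3w = u + v`); conversely a stacking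
point within `33/10` of `φ (D i) = 0` has `|k| ≤ 4` and in-layer coordinates in the box, by its
coordinates.  All [folklore].
-/

noncomputable section

namespace Summit.AtomisticToContinuum.Crystallization.Theorems

namespace OneStacking

open Literature.MathematicalPhysics.StatisticalMechanics Literature.Geometry.DiscreteGeometry
open RealInnerProductSpace V3

/-- `u = (1, 0, 0)`. -/
local notation "𝐮" => triangularVec₁ (1 : ℝ)
/-- `v = (1/2, √3/2, 0)`. -/
local notation "𝐯" => triangularVec₂ (1 : ℝ)
/-- `w = (1/2, √3/6, 0)`. -/
local notation "𝐰" => barlowOffset (1 : ℝ)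
/-- `√(2/3) e₃`. -/
local notation "𝐞" => layerNormal (Real.sqrt (2 / 3))

/-! ### Barlow points in frame form -/

/-- **A frame combination with letter `c` is a Barlow point** once `haggLabel s k = c + 3q`:
`a u + b v + c w + k e = barlowPos 1 h s k (a − q) (b − q)`. [folklore] -/
theorem comb_eq_barlowPos {s : ℤ → ℤ} {k a b c q : ℤ} (hl : haggLabel s k = c + 3 * q) :
    (a : ℝ) • (𝐮 : E3) + (b : ℝ) • 𝐯 + (c : ℝ) • 𝐰 + (k : ℝ) • 𝐞 =
      barlowPos 1 (Real.sqrt (2 / 3)) s k (a - q) (b - q) := by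
  have hw : (𝐰 : E3) = (3 : ℝ)⁻¹ • ((𝐮 : E3) + 𝐯) := by
    rw [← three_smul_barlowOffset, smul_smul, inv_mul_cancel₀ three_ne_zero, one_smul]
  rw [barlowPos, hl, hw]
  push_cast
  module

/-- Coordinates of a frame combination: `x₀ = a + b/2 + c/2`, `x₁ = (√3/2)(b + c/3)`,
`x₂ = k √(2/3)`. [folklore] -/
theorem comb_apply (a b c k : ℝ) :
    (a • (𝐮 : E3) + b • 𝐯 + c • 𝐰 + k • 𝐞) 0 = a + b / 2 + c / 2 ∧
    (a • (𝐮 : E3) + b • 𝐯 + c • 𝐰 + k • 𝐞) 1 = Real.sqrt 3 / 2 * (b + c / 3) ∧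
    (a • (𝐮 : E3) + b • 𝐯 + c • 𝐰 + k • 𝐞) 2 = k * Real.sqrt (2 / 3) := by
  refine ⟨?_, ?_, ?_⟩ <;> simp [triangularVec₁, triangularVec₂, barlowOffset, layerNormal] <;> ring

/-- **Box bounds from the norm**: a frame combination with letter `c ∈ [0, 2]` and squared norm
`≤ (33/10)²` has `|k| ≤ 4` and in-layer coordinates in `[-8, 8]`. [folklore] -/
theorem box_of_sq_le {a b k c : ℤ} (hc0 : 0 ≤ c) (hc2 : c ≤ 2)
    (h : ((a : ℝ) + b / 2 + c / 2) ^ 2 + (Real.sqrt 3 / 2 * (b + c / 3)) ^ 2 + (k * Real.sqrt (2 / 3)) ^ 2 ≤ 1089 / 100) :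
    (-4 ≤ k ∧ k ≤ 4) ∧ (-8 ≤ a ∧ a ≤ 8) ∧ (-8 ≤ b ∧ b ≤ 8) := by
  have h3 : Real.sqrt 3 * Real.sqrt 3 = 3 := Real.mul_self_sqrt (by norm_num)
  have h23 : Real.sqrt (2 / 3) * Real.sqrt (2 / 3) = 2 / 3 := Real.mul_self_sqrt (by norm_num)
  have hc0' : (0 : ℝ) ≤ c := by exact_mod_cast hc0
  have hc2' : (c : ℝ) ≤ 2 := by exact_mod_cast hc2
  have s0 : 0 ≤ ((a : ℝ) + b / 2 + c / 2) ^ 2 := sq_nonneg _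
  have s1 : 0 ≤ (Real.sqrt 3 / 2 * ((b : ℝ) + c / 3)) ^ 2 := sq_nonneg _
  have s2 : 0 ≤ ((k : ℝ) * Real.sqrt (2 / 3)) ^ 2 := sq_nonneg _
  have e1 : (Real.sqrt 3 / 2 * ((b : ℝ) + c / 3)) ^ 2 = 3 / 4 * ((b : ℝ) + c / 3) ^ 2 := by nlinarith [h3]
  have e2 : ((k : ℝ) * Real.sqrt (2 / 3)) ^ 2 = 2 / 3 * (k : ℝ) ^ 2 := by nlinarith [h23]
  have hk2 : (k : ℝ) ^ 2 < 25 := by nlinarith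
  have hb2 : ((b : ℝ) + c / 3) ^ 2 < 16 := by nlinarith
  have ha2 : ((a : ℝ) + b / 2 + c / 2) ^ 2 < 12 := by nlinarith
  have hk : -4 ≤ k ∧ k ≤ 4 := by
    have habs : |(k : ℝ)| < 5 := abs_lt_of_sq_lt_sq (by norm_num; linarith) (by norm_num)
    have : (k : ℝ) < 5 ∧ (-5 : ℝ) < k := ⟨(abs_lt.1 habs).2, (abs_lt.1 habs).1⟩
    have h1 : k < 5 := by exact_mod_cast this.1
    have h2 : -5 < k := by exact_mod_cast this.2
    omega
  have hb : -8 ≤ b ∧ b ≤ 8 := by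
    have habs : |(b : ℝ) + c / 3| < 4 := abs_lt_of_sq_lt_sq (by norm_num; linarith) (by norm_num)
    have hlt : (b : ℝ) + c / 3 < 4 ∧ (-4 : ℝ) < b + c / 3 := ⟨(abs_lt.1 habs).2, (abs_lt.1 habs).1⟩
    have h1 : (b : ℝ) < 5 := by linarith
    have h2 : (-5 : ℝ) < b := by linarith
    have h1' : b < 5 := by exact_mod_cast h1
    have h2' : -5 < b := by exact_mod_cast h2
    omega
  have ha : -8 ≤ a ∧ a ≤ 8 := by
    have hb1 : (b : ℝ) ≤ 8 := by exact_mod_cast hb.2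
    have hb2 : (-8 : ℝ) ≤ b := by exact_mod_cast hb.1
    have habs : |(a : ℝ) + b / 2 + c / 2| < 4 := abs_lt_of_sq_lt_sq (by norm_num; linarith) (by norm_num)
    have hlt : (a : ℝ) + b / 2 + c / 2 < 4 ∧ (-4 : ℝ) < a + b / 2 + c / 2 := ⟨(abs_lt.1 habs).2, (abs_lt.1 habs).1⟩
    have h1 : (a : ℝ) < 9 := by linarith
    have h2 : (-9 : ℝ) < a := by linarith
    have h1' : a < 9 := by exact_mod_cast h1
    have h2' : -9 < a := by exact_mod_cast h2
    omega
  exact ⟨hk, ha, hb⟩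

/-! ### The rigid motion -/

namespace Hyp

variable (H : Hyp)

/-- **The rigid motion of the stub**: `x ↦ Ψ (Qᵢ⁻¹ (x − D i))`. [folklore] -/
def motion (Ψ : E3 →ₗᵢ[ℝ] E3) : E3 ≃ᵃⁱ[ℝ] E3 :=
  (AffineIsometryEquiv.vaddConst ℝ (H.D H.i)).symm.trans
    ((H.rootQ.symm.trans (Ψ.toLinearIsometryEquiv rfl)).toAffineIsometryEquiv)

/-- The motion on the sites: `φ (D j) = (√2)⁻¹ • Ψ (pos j)`. [folklore] -/
theorem motion_apply_D (Ψ : E3 →ₗᵢ[ℝ] E3) (j : Fin H.N) :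
    H.motion Ψ (H.D j) = (Real.sqrt 2)⁻¹ • Ψ (H.pos j) := by
  have h2 : Real.sqrt 2 ≠ 0 := by positivity
  simp only [motion, AffineIsometryEquiv.coe_trans, Function.comp_apply, AffineIsometryEquiv.coe_vaddConst_symm,
    vsub_eq_sub, LinearIsometryEquiv.coe_toAffineIsometryEquiv, LinearIsometryEquiv.coe_trans,
    LinearIsometry.coe_toLinearIsometryEquiv, Hyp.pos, LinearIsometry.map_smul, smul_smul, inv_mul_cancel₀ h2,
    one_smul]

/-- The motion fixes the centre at the origin. [folklore] -/
theorem motion_apply_Di (Ψ : E3 →ₗᵢ[ℝ] E3) : H.motion Ψ (H.D H.i) = 0 := by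
  rw [motion_apply_D, H.pos_i, map_zero, smul_zero]

/-- Distances to the centre and the shadow ball: `dist (D j) (D i) ≤ 33/10 ↔ ‖pos j‖² ≤ 1089/50`.
[folklore] -/
theorem dist_le_iff (j : Fin H.N) : dist (H.D j) (H.D H.i) ≤ 33 / 10 ↔ ‖H.pos j‖ ^ 2 ≤ 1089 / 50 := by
  rw [H.norm_pos]
  have h0 : 0 ≤ dist (H.D j) (H.D H.i) := dist_nonneg
  constructor
  · intro h; nlinarith [h, h0]
  · intro h; nlinarith [h, h0]

end Hyp

/-! ### The bridge -/

/-- **From the shadow-frame conclusion to the conclusion of the stub.** [folklore] -/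
theorem concl_of_dev (H : Hyp) (C : H.dev.Concl) :
    ∃ (s : ℤ → ℤ) (φ : E3 ≃ᵃⁱ[ℝ] E3), IsHaggSeq s ∧
      (∀ j : Fin H.N, (∃ w : (bondGraph H.η H.y).Walk H.i j, w.length ≤ 5) →
        dist (H.D j) (H.D H.i) ≤ 33 / 10 → φ (H.D j) ∈ barlowStacking 1 (Real.sqrt (2 / 3)) s) ∧
      (∀ z ∈ barlowStacking 1 (Real.sqrt (2 / 3)) s, dist z (φ (H.D H.i)) ≤ 33 / 10 →
        ∃ j : Fin H.N, (∃ w : (bondGraph H.η H.y).Walk H.i j, w.length ≤ 5) ∧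
          dist (H.D j) (H.D H.i) ≤ 33 / 10 ∧ φ (H.D j) = z) ∧
      (∀ j k : Fin H.N, (∃ w : (bondGraph H.η H.y).Walk H.i j, w.length ≤ 5) →
        (∃ w : (bondGraph H.η H.y).Walk H.i k, w.length ≤ 5) →
        dist (H.D j) (H.D H.i) ≤ 33 / 10 → dist (H.D k) (H.D H.i) ≤ 33 / 10 → H.D j = H.D k → j = k) := by
  obtain ⟨F, L, hF, hL, hmem, hsurj, hinj⟩ := C
  obtain ⟨Ψ, hΨ1, hΨ2, hΨw, hΨz⟩ := exists_frame_isometry hF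
  obtain ⟨-, hLrange, -⟩ := lettersOK_spec hL
  have h2 : Real.sqrt 2 ≠ 0 := by positivity
  -- a site at a frame point goes to the Barlow combination
  have hpt : ∀ (j : Fin H.N) (k a b c : ℤ), H.pos j = toE3 (F.pt k a b c) →
      H.motion Ψ (H.D j) = (a : ℝ) • (𝐮 : E3) + (b : ℝ) • 𝐯 + (c : ℝ) • 𝐰 + (k : ℝ) • 𝐞 := by
    intro j k a b c hj
    rw [H.motion_apply_D, hj, frame_pt hΨ1 hΨ2 hΨw hΨz, smul_smul, inv_mul_cancel₀ h2, one_smul]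
  refine ⟨haggOf L, H.motion Ψ, isHaggSeq_haggOf L, ?_, ?_, ?_⟩
  · -- membership
    intro j hj hd
    obtain ⟨k, a, b, hbox, hpj⟩ := hmem j hj ((H.dist_le_iff j).1 hd)
    obtain ⟨q, hq⟩ := haggLabel_haggOf hL k hbox.1 hbox.2.1
    refine ⟨k, a - q, b - q, ?_⟩
    rw [hpt j k a b _ hpj, comb_eq_barlowPos (q := q) (by linarith)]
  · -- surjectivity
    intro z hz hd
    obtain ⟨k, i', j', rfl⟩ := mem_barlowStacking_iff.1 hz
    rw [H.motion_apply_Di, dist_zero_right] at hd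
    have hn0 : ‖barlowPos 1 (Real.sqrt (2 / 3)) (haggOf L) k i' j'‖ ^ 2 ≤ 1089 / 100 := by
      nlinarith [hd, norm_nonneg (barlowPos 1 (Real.sqrt (2 / 3)) (haggOf L) k i' j')]
    -- the layer, from the height alone
    have hk : -4 ≤ k ∧ k ≤ 4 := by
      have hn := hn0
      rw [norm_sq_fin3, barlowPos_apply_two] at hn
      have h23 : Real.sqrt (2 / 3) * Real.sqrt (2 / 3) = 2 / 3 := Real.mul_self_sqrt (by norm_num)
      have hz2 : 2 / 3 * (k : ℝ) ^ 2 ≤ 1089 / 100 := by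
        nlinarith [hn, h23, sq_nonneg (barlowPos 1 (Real.sqrt (2 / 3)) (haggOf L) k i' j' 0),
          sq_nonneg (barlowPos 1 (Real.sqrt (2 / 3)) (haggOf L) k i' j' 1)]
      have habs : |(k : ℝ)| < 5 := abs_lt_of_sq_lt_sq (by norm_num; linarith) (by norm_num)
      have h1 : k < 5 := by exact_mod_cast (abs_lt.1 habs).2
      have h1' : -5 < k := by exact_mod_cast (abs_lt.1 habs).1
      omega
    -- the letter and the reduced label
    obtain ⟨q, hq⟩ := haggLabel_haggOf hL k hk.1 hk.2
    obtain ⟨hc0, hc2⟩ := hLrange k hk.1 hk.2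
    have hlab : haggLabel (haggOf L) k = St.letter L k + 3 * q := by linarith
    have hzeq : barlowPos 1 (Real.sqrt (2 / 3)) (haggOf L) k i' j' =
        ((i' + q : ℤ) : ℝ) • (𝐮 : E3) + ((j' + q : ℤ) : ℝ) • 𝐯 + ((St.letter L k : ℤ) : ℝ) • 𝐰 + (k : ℝ) • 𝐞 := by
      rw [comb_eq_barlowPos (q := q) hlab]; congr 1 <;> ring
    -- the in-layer coordinates are in the box
    have hbox : (-4 ≤ k ∧ k ≤ 4) ∧ (-8 ≤ i' + q ∧ i' + q ≤ 8) ∧ (-8 ≤ j' + q ∧ j' + q ≤ 8) := by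
      have hn := hn0
      rw [hzeq, norm_sq_fin3] at hn
      obtain ⟨e0, e1, e2⟩ := comb_apply ((i' + q : ℤ) : ℝ) ((j' + q : ℤ) : ℝ) ((St.letter L k : ℤ) : ℝ) (k : ℝ)
      rw [e0, e1, e2] at hn
      exact box_of_sq_le hc0 hc2 (by push_cast at hn ⊢; exact hn)
    -- the shadow point is in the shadow ball; the site
    set Z := ((i' + q : ℤ) : ℝ) • (𝐮 : E3) + ((j' + q : ℤ) : ℝ) • 𝐯 + ((St.letter L k : ℤ) : ℝ) • 𝐰 + (k : ℝ) • 𝐞 with hZ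
    have hΨpt : Ψ (toE3 (F.pt k (i' + q) (j' + q) (St.letter L k))) = Real.sqrt 2 • Z := frame_pt hΨ1 hΨ2 hΨw hΨz _ _ _ _
    have hnpt : ‖toE3 (F.pt k (i' + q) (j' + q) (St.letter L k))‖ ^ 2 ≤ 1089 / 50 := by
      rw [← Ψ.norm_map, hΨpt, norm_smul, Real.norm_of_nonneg (by positivity), mul_pow, Real.sq_sqrt (by norm_num), ← hzeq]
      linarith
    obtain ⟨j, hj, hpj⟩ := hsurj k (i' + q) (j' + q) ⟨hbox.1.1, hbox.1.2, hbox.2.1.1, hbox.2.1.2, hbox.2.2.1, hbox.2.2.2⟩ hnpt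
    have hpj' : H.pos j = toE3 (F.pt k (i' + q) (j' + q) (St.letter L k)) := hpj
    refine ⟨j, hj, (H.dist_le_iff j).2 (by rw [hpj']; exact hnpt), ?_⟩
    rw [hzeq, H.motion_apply_D, hpj', hΨpt, smul_smul, inv_mul_cancel₀ h2, one_smul]
  · -- injectivity
    intro j k hj hk hdj _ hjk
    refine hinj j k hj hk ((H.dist_le_iff j).1 hdj) ?_
    show H.pos j = H.pos k
    simp only [Hyp.pos, hjk]

end OneStacking

end Summit.AtomisticToContinuum.Crystallization.Theorems
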